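import Summits.PneNP.PneNP.Theorems.ExpanderLinearGeneratorsColumnTwoExpanderCore

/-!
# PneNP / ExpanderLinearGenerators — large clique minors in GLOBAL expanders of any rate:
the iteration

Route `PneNP/ExpanderLinearGenerators` (column-weight-two routing machinery), support for crux
stmt-PneNP-11427 (`EvenHypergraphTseitinDepthFregeLB` of route `PneNP/MatroidTseitin`, whose case
`k = 1` is Tseitin on bounded-degree expander graphs). On top of the robust core of
`…ColumnTwoExpanderCore`, the Krivelevich–Sudakov iteration with MONOTONE DEATH: branch sets are
built one at a time inside the current core (`clique_step`), each an `ℓ`-set joined to every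
earlier branch set that still has a core neighbour; the deleted rows only grow and the maximal
slack set is chosen to grow with them, so the core shrinks, death (losing all core neighbours)
is permanent, and the branch sets alive at the end are pairwise adjacent; global expansion bounds
the dead ones by `b/a` times the live ones.

* `exists_clique_minor_of_expander` — if every `W ⊆ U` with `2|W| ≤ N = |U|` has
  `a|W| ≤ b|nbr U W|` (`1 ≤ a ≤ b`), `(2b)^{t₁} N < (2b+a)^{t₁}`, `ℓ ≥ 1 + h(2(t₁+6b)+2)` and
  `16 b · hℓ · (a+2b) ≤ a² N`, then there are `≥ a h/(a+b)` pairwise disjoint, pairwise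
  adjacent, connected `ℓ`-sets of rows (order `Ω(α^{5/2} (N/log N)^{1/2})` for `α = a/b`);
* `exists_clique_minor_fin` — the same, indexed by `Fin M` for `(a+b)M ≤ a h` (the input format
  of `ColumnTwo.exists_routing_subst`).

References: M. Krivelevich, B. Sudakov, *Minors in expanding graphs*, GAFA 19 (2009) 294–331,
Theorem 1.1 and §4; M. Krivelevich, *Expanders — how to find them, and what to find in them*,
Surveys in Combinatorics 2019 (LMS Lecture Note Ser. 456), §8.
-/

namespace Summit.PneNP.PneNP.Theorems.ColumnTwo

set_option linter.dupNamespace false -- `Summit.PneNP.PneNP.…`: summit = sub-problem (D-0017)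

open Finset Literature.Computability.MetaComplexity

variable {ι : Type*} [DecidableEq ι] {S : ι → Finset ℕ}

/-- The neighbourhood of the empty set is empty. [folklore] -/
theorem nbr_empty (V : Finset ι) : nbr S V (∅ : Finset ι) = ∅ := by
  rw [Finset.eq_empty_iff_forall_notMem]
  intro j hj
  obtain ⟨-, -, i, hi, -⟩ := mem_nbr.1 hj
  exact Finset.notMem_empty i hi

/-! ### The iteration -/

section Iteration

variable {U : Finset ι} {N a b h ℓ t₁ : ℕ}

/-- **One step of the Krivelevich–Sudakov iteration with monotone death.** Given `t < h` branch
sets `A 0, …, A (t-1)` (connected `ℓ`-subsets of `U`), and a maximal slack set `X` for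
`R = ⋃ A i`, there is a new connected `ℓ`-set `T` inside the core `(U \ R) \ X` adjacent to every
earlier set having a core neighbour, and a maximal slack set `X' ⊇ X` for `R ∪ T`. Budget:
`16 b · hℓ · (a+2b) ≤ a² N`, `ℓ ≥ 1 + h(2(t₁+6b)+2)`, `(2b)^{t₁} N < (2b+a)^{t₁}`, `1 ≤ a ≤ b`.
[cite: KrivelevichSudakov2009Minors, §4] -/
theorem clique_step (hN : U.card = N) (ha : 1 ≤ a) (hb : 1 ≤ b) (hab : a ≤ b)
    (hexp : ∀ W ⊆ U, 2 * W.card ≤ N → a * W.card ≤ b * (nbr S U W).card)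
    (ht₁ : (2 * b) ^ t₁ * N < (2 * b + a) ^ t₁)
    (hℓ : 1 + h * (2 * (t₁ + 6 * b) + 2) ≤ ℓ)
    (hbud : 16 * b * (h * ℓ) * (a + 2 * b) ≤ a * a * N)
    {t : ℕ} (ht : t < h) (A : ℕ → Finset ι) (X : Finset ι)
    (hA : ∀ i < t, A i ⊆ U ∧ IsConn S (A i) ∧ (A i).card = ℓ)
    (hX : X ⊆ U \ (Finset.range t).biUnion A) (hX4 : 4 * X.card ≤ N)
    (hXs : 2 * b * (nbr S U X \ (Finset.range t).biUnion A).card ≤ a * X.card)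
    (hmax : ∀ Y, X ⊆ Y → Y ⊆ U \ (Finset.range t).biUnion A → 4 * Y.card ≤ N →
      2 * b * (nbr S U Y \ (Finset.range t).biUnion A).card ≤ a * Y.card → Y = X) :
    ∃ (T X' : Finset ι), T ⊆ (U \ (Finset.range t).biUnion A) \ X ∧ IsConn S T ∧ T.card = ℓ ∧
      X ⊆ X' ∧ X' ⊆ U \ ((Finset.range t).biUnion A ∪ T) ∧ 4 * X'.card ≤ N ∧
      2 * b * (nbr S U X' \ ((Finset.range t).biUnion A ∪ T)).card ≤ a * X'.card ∧
      (∀ Y, X' ⊆ Y → Y ⊆ U \ ((Finset.range t).biUnion A ∪ T) → 4 * Y.card ≤ N →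
        2 * b * (nbr S U Y \ ((Finset.range t).biUnion A ∪ T)).card ≤ a * Y.card → Y = X') ∧
      ∀ i < t, (∃ x ∈ A i, ∃ z ∈ (U \ (Finset.range t).biUnion A) \ X, (S x ∩ S z).Nonempty) →
        ∃ x ∈ A i, ∃ y ∈ T, (S x ∩ S y).Nonempty := by
  classical
  set R := (Finset.range t).biUnion A with hR
  set C := (U \ R) \ X with hC
  -- sizes and budgets
  have hRU : R ⊆ U := Finset.biUnion_subset.2 fun i hi => (hA i (Finset.mem_range.1 hi)).1
  have hRcard : R.card ≤ h * ℓ := by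
    calc R.card ≤ ∑ i ∈ Finset.range t, (A i).card := Finset.card_biUnion_le
      _ = ∑ i ∈ Finset.range t, ℓ :=
          Finset.sum_congr rfl fun i hi => (hA i (Finset.mem_range.1 hi)).2.2
      _ = t * ℓ := by rw [Finset.sum_const, Finset.card_range, smul_eq_mul]
      _ ≤ h * ℓ := Nat.mul_le_mul_right _ ht.le
  have hb1 : 16 * b * R.card ≤ a * N := by
    have h1 : a * (16 * b * R.card) ≤ a * (a * N) := by
      calc a * (16 * b * R.card) ≤ a * (16 * b * (h * ℓ)) := by gcongr
        _ ≤ 16 * b * (h * ℓ) * (a + 2 * b) := by nlinarith [Nat.zero_le (16 * b * (h * ℓ))]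
        _ ≤ a * (a * N) := le_of_le_of_eq hbud (by ring)
    exact Nat.le_of_mul_le_mul_left h1 ha
  have hXsmall : a * X.card ≤ 2 * b * R.card :=
    card_le_of_slack hN hexp (hX.trans Finset.sdiff_subset) hX4 hXs
  have hloss' : 16 * b * (R.card + X.card) ≤ a * N := by
    have h1 : a * (16 * b * (R.card + X.card)) ≤ a * (a * N) := by
      calc a * (16 * b * (R.card + X.card))
          = 16 * b * (a * R.card) + 16 * b * (a * X.card) := by ring
        _ ≤ 16 * b * (a * R.card) + 16 * b * (2 * b * R.card) := by gcongr
        _ = 16 * b * R.card * (a + 2 * b) := by ring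
        _ ≤ 16 * b * (h * ℓ) * (a + 2 * b) := by gcongr
        _ ≤ a * (a * N) := le_of_le_of_eq hbud (by ring)
    exact Nat.le_of_mul_le_mul_left h1 ha
  have h32 : 32 * ℓ ≤ N := by
    have h1 : 1 ≤ h := by omega
    have h2 : b * b * (32 * ℓ) ≤ b * b * N := by
      calc b * b * (32 * ℓ) = 16 * b * (1 * ℓ) * (2 * b) := by ring
        _ ≤ 16 * b * (h * ℓ) * (a + 2 * b) := by gcongr; omega
        _ ≤ a * a * N := hbud
        _ ≤ b * b * N := by gcongr
    exact Nat.le_of_mul_le_mul_left h2 (by positivity)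
  have hCU : C ⊆ U := Finset.sdiff_subset.trans Finset.sdiff_subset
  have hUC : U \ C ⊆ R ∪ X := by
    intro j hj
    rw [Finset.mem_sdiff] at hj
    by_contra hj'
    rw [Finset.mem_union, not_or] at hj'
    exact hj.2 (Finset.mem_sdiff.2 ⟨Finset.mem_sdiff.2 ⟨hj.1, hj'.1⟩, hj'.2⟩)
  have hloss : 16 * b * (U \ C).card ≤ a * N := by
    have h1 : (U \ C).card ≤ R.card + X.card :=
      (Finset.card_le_card hUC).trans (Finset.card_union_le _ _)
    exact le_trans (Nat.mul_le_mul_left _ h1) hloss'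
  have hCN : C.card ≤ N := hN ▸ Finset.card_le_card hCU
  have hcore := core_expansion hN ha hexp hRU hX hX4 hXs hmax hb1
  -- the core is nonempty
  have hCcard : C.card = N - R.card - X.card := by
    rw [hC, Finset.card_sdiff_of_subset hX, Finset.card_sdiff_of_subset hRU, hN]
  have hCne : C.Nonempty := by
    rw [← Finset.card_pos, hCcard]
    have h1 : 16 * (R.card + X.card) ≤ N := by
      have h2 : 16 * b * (R.card + X.card) ≤ b * N := hloss'.trans (Nat.mul_le_mul_right _ hab)
      have h3 : b * (16 * (R.card + X.card)) ≤ b * N := by linarith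
      exact Nat.le_of_mul_le_mul_left h3 (by omega)
    omega
  obtain ⟨v, hv⟩ := hCne
  -- connectors to the live branch sets
  have hdat : ∀ i, ∃ P ⊆ C, IsConn S P ∧ v ∈ P ∧ P.card ≤ 2 * (t₁ + 6 * b) + 2 ∧
      ((i < t ∧ ∃ x ∈ A i, ∃ z ∈ C, (S x ∩ S z).Nonempty) →
        ∃ x ∈ A i, ∃ z ∈ P, (S x ∩ S z).Nonempty) := by
    intro i
    by_cases hi : i < t ∧ ∃ x ∈ A i, ∃ z ∈ C, (S x ∩ S z).Nonempty
    · obtain ⟨-, x, hx, z, hz, hxz⟩ := hi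
      obtain ⟨P, hPC, hPc, hvP, hzP, hPcard⟩ :=
        exists_conn_pair hN ha hb hexp hCU hloss hcore ht₁ hv hz
      exact ⟨P, hPC, hPc, hvP, hPcard, fun _ => ⟨x, hx, z, hzP, hxz⟩⟩
    · exact ⟨{v}, Finset.singleton_subset_iff.2 hv, isConn_singleton v, Finset.mem_singleton_self v,
        by simp, fun h' => absurd h' hi⟩
  choose P hPC hPc hvP hPcard hPadj using hdat
  set T₀ := insert v ((Finset.range t).biUnion P) with hT₀
  have hT₀C : T₀ ⊆ C := Finset.insert_subset hv (Finset.biUnion_subset.2 fun i _ => hPC i)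
  have hT₀c : IsConn S T₀ := isConn_insert_biUnion _ P fun i _ _ => ⟨hPc i, hvP i⟩
  have hT₀card : T₀.card ≤ ℓ := by
    calc T₀.card ≤ ((Finset.range t).biUnion P).card + 1 := Finset.card_insert_le _ _
      _ ≤ (∑ i ∈ Finset.range t, (P i).card) + 1 := by gcongr; exact Finset.card_biUnion_le
      _ ≤ (∑ i ∈ Finset.range t, (2 * (t₁ + 6 * b) + 2)) + 1 := by
          gcongr with i hi
          exact hPcard i
      _ = t * (2 * (t₁ + 6 * b) + 2) + 1 := by
          rw [Finset.sum_const, Finset.card_range, smul_eq_mul]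
      _ ≤ h * (2 * (t₁ + 6 * b) + 2) + 1 := by gcongr
      _ ≤ ℓ := by omega
  -- padding to exactly `ℓ` rows
  have hbig := ball_core_eighth hcore hCN ht₁ hT₀C ⟨v, Finset.mem_insert_self v _⟩
  obtain ⟨T, hT₀T, hTball, hTc, hTcard⟩ :=
    exists_conn_superset_card_eq (V := (U \ R) \ X) (t := t₁) hT₀c hT₀card (by omega)
  have hTC : T ⊆ C := hTball.trans (ball_subset hT₀C t₁)
  -- the new maximal slack set
  have hXR' : X ⊆ U \ (R ∪ T) := by
    intro x hx
    have h1 := Finset.mem_sdiff.1 (hX hx)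
    refine Finset.mem_sdiff.2 ⟨h1.1, fun h2 => ?_⟩
    rcases Finset.mem_union.1 h2 with h2 | h2
    · exact h1.2 h2
    · exact (Finset.mem_sdiff.1 (hTC h2)).2 hx
  have hXs' : 2 * b * (nbr S U X \ (R ∪ T)).card ≤ a * X.card := by
    refine le_trans (Nat.mul_le_mul_left _ (Finset.card_le_card ?_)) hXs
    exact Finset.sdiff_subset_sdiff (Finset.Subset.refl _) Finset.subset_union_left
  obtain ⟨X', hXX', hX'U, hX'4, hX's, hX'max⟩ := exists_maximal_slack hXR' hX4 hXs'
  refine ⟨T, X', hTC, hTc, hTcard, hXX', hX'U, hX'4, hX's, hX'max, fun i hi hlive => ?_⟩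
  obtain ⟨x, hx, z, hz, hxz⟩ := hPadj i ⟨hi, hlive⟩
  exact ⟨x, hx, z, hT₀T (Finset.mem_insert_of_mem
    (Finset.mem_biUnion.2 ⟨i, Finset.mem_range.2 hi, hz⟩)), hxz⟩

/-- **Large clique minors in expanders of any rate** (Krivelevich–Sudakov). Let every
`W ⊆ U` with `2|W| ≤ N = |U|` satisfy `a|W| ≤ b|nbr U W|` (`1 ≤ a ≤ b`), let
`(2b)^{t₁} N < (2b+a)^{t₁}`, `ℓ ≥ 1 + h(2(t₁+6b)+2)` and `16 b · hℓ · (a+2b) ≤ a² N`. Then `U`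
contains a family `G` of pairwise disjoint, pairwise adjacent, connected `ℓ`-sets of rows with
`a h ≤ (a+b)|G|`. [cite: KrivelevichSudakov2009Minors, Thm. 1.1] -/
theorem exists_clique_minor_of_expander (hN : U.card = N) (ha : 1 ≤ a) (hb : 1 ≤ b) (hab : a ≤ b)
    (hexp : ∀ W ⊆ U, 2 * W.card ≤ N → a * W.card ≤ b * (nbr S U W).card)
    (ht₁ : (2 * b) ^ t₁ * N < (2 * b + a) ^ t₁)
    (hℓ : 1 + h * (2 * (t₁ + 6 * b) + 2) ≤ ℓ)
    (hbud : 16 * b * (h * ℓ) * (a + 2 * b) ≤ a * a * N) :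
    ∃ (G : Finset ℕ) (A : ℕ → Finset ι), a * h ≤ (a + b) * G.card ∧
      (∀ i ∈ G, A i ⊆ U ∧ IsConn S (A i) ∧ (A i).card = ℓ) ∧
      ∀ i ∈ G, ∀ j ∈ G, i ≠ j →
        Disjoint (A i) (A j) ∧ ∃ x ∈ A i, ∃ y ∈ A j, (S x ∩ S y).Nonempty := by
  classical
  -- the invariant of the iteration
  have key : ∀ t ≤ h, ∃ (A : ℕ → Finset ι) (X : Finset ι),
      (∀ i < t, A i ⊆ U ∧ IsConn S (A i) ∧ (A i).card = ℓ) ∧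
      (∀ i j, i < j → j < t → Disjoint (A i) (A j)) ∧
      (X ⊆ U \ (Finset.range t).biUnion A ∧ 4 * X.card ≤ N ∧
        2 * b * (nbr S U X \ (Finset.range t).biUnion A).card ≤ a * X.card) ∧
      (∀ Y, X ⊆ Y → Y ⊆ U \ (Finset.range t).biUnion A → 4 * Y.card ≤ N →
        2 * b * (nbr S U Y \ (Finset.range t).biUnion A).card ≤ a * Y.card → Y = X) ∧
      (∀ i j, i < j → j < t →
        (∃ x ∈ A i, ∃ z ∈ (U \ (Finset.range t).biUnion A) \ X, (S x ∩ S z).Nonempty) →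
        ∃ x ∈ A i, ∃ y ∈ A j, (S x ∩ S y).Nonempty) := by
    intro t
    induction t with
    | zero =>
      intro _
      obtain ⟨X, -, hXU, hX4, hXs, hmax⟩ := exists_maximal_slack (S := S) (U := U) (R := ∅)
        (X₀ := ∅) (N := N) (a := a) (b := b) (Finset.empty_subset _) (by simp) (by simp [nbr_empty])
      refine ⟨fun _ => ∅, X, fun i hi => absurd hi (Nat.not_lt_zero i),
        fun i j _ hj => absurd hj (Nat.not_lt_zero j), ?_, ?_,
        fun i j _ hj => absurd hj (Nat.not_lt_zero j)⟩
      · simpa using And.intro hXU (And.intro hX4 hXs)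
      · simpa using hmax
    | succ t ih =>
      intro hth
      obtain ⟨A, X, hA, hAd, ⟨hX, hX4, hXs⟩, hmax, hcliq⟩ := ih (by omega)
      obtain ⟨T, X', hTC, hTc, hTcard, hXX', hX'U, hX'4, hX's, hX'max, hadj⟩ :=
        clique_step hN ha hb hab hexp ht₁ hℓ hbud (show t < h by omega) A X hA hX hX4 hXs hmax
      set A' : ℕ → Finset ι := fun i => if i = t then T else A i with hA'
      have hA't : A' t = T := by simp [hA']
      have hA'i : ∀ i, i ≠ t → A' i = A i := fun i hi => by simp [hA', hi]
      have hR' : (Finset.range (t + 1)).biUnion A' = (Finset.range t).biUnion A ∪ T := by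
        rw [Finset.range_add_one, Finset.biUnion_insert, hA't, Finset.union_comm]
        congr 1
        exact Finset.biUnion_congr rfl fun i hi =>
          hA'i i (by have := Finset.mem_range.1 hi; omega)
      refine ⟨A', X', ?_, ?_, ?_, ?_, ?_⟩
      · intro i hi
        rcases Nat.lt_succ_iff_lt_or_eq.1 hi with hi | rfl
        · rw [hA'i i hi.ne]; exact hA i hi
        · rw [hA't]
          exact ⟨hTC.trans (Finset.sdiff_subset.trans Finset.sdiff_subset), hTc, hTcard⟩
      · intro i j hij hj
        rcases Nat.lt_succ_iff_lt_or_eq.1 hj with hj | rfl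
        · rw [hA'i i (by omega), hA'i j hj.ne]; exact hAd i j hij hj
        · rw [hA't, hA'i i hij.ne]
          refine Finset.disjoint_left.2 fun x hxi hxT => ?_
          have h1 := Finset.mem_sdiff.1 (Finset.mem_sdiff.1 (hTC hxT)).1
          exact h1.2 (Finset.mem_biUnion.2 ⟨i, Finset.mem_range.2 hij, hxi⟩)
      · rw [hR']; exact ⟨hX'U, hX'4, hX's⟩
      · rw [hR']; exact hX'max
      · intro i j hij hj hlive
        rw [hR'] at hlive
        -- the earlier set is live in the OLD core as well
        have hlive' : ∃ x ∈ A i, ∃ z ∈ (U \ (Finset.range t).biUnion A) \ X,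
            (S x ∩ S z).Nonempty := by
          obtain ⟨x, hx, z, hz, hxz⟩ := hlive
          rw [hA'i i (by omega)] at hx
          refine ⟨x, hx, z, ?_, hxz⟩
          have h1 := Finset.mem_sdiff.1 hz
          have h2 := Finset.mem_sdiff.1 h1.1
          exact Finset.mem_sdiff.2 ⟨Finset.mem_sdiff.2 ⟨h2.1, fun h3 =>
            h2.2 (Finset.mem_union_left _ h3)⟩, fun h3 => h1.2 (hXX' h3)⟩
        rcases Nat.lt_succ_iff_lt_or_eq.1 hj with hj | rfl
        · rw [hA'i i (by omega), hA'i j hj.ne]; exact hcliq i j hij hj hlive'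
        · rw [hA't, hA'i i hij.ne]; exact hadj i hij hlive'
  -- the final family: the live branch sets
  obtain ⟨A, X, hA, hAd, ⟨hX, hX4, hXs⟩, -, hcliq⟩ := key h le_rfl
  set R := (Finset.range h).biUnion A with hR
  set L := (Finset.range h).filter fun i =>
    ∃ x ∈ A i, ∃ z ∈ (U \ R) \ X, (S x ∩ S z).Nonempty with hL
  set D := (Finset.range h).filter fun i =>
    ¬ ∃ x ∈ A i, ∃ z ∈ (U \ R) \ X, (S x ∩ S z).Nonempty with hD
  have hRU : R ⊆ U := Finset.biUnion_subset.2 fun i hi => (hA i (Finset.mem_range.1 hi)).1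
  have hdisj : ∀ i ∈ Finset.range h, ∀ j ∈ Finset.range h, i ≠ j → Disjoint (A i) (A j) := by
    intro i hi j hj hne
    rcases lt_or_gt_of_ne hne with h1 | h1
    · exact hAd i j h1 (Finset.mem_range.1 hj)
    · exact (hAd j i h1 (Finset.mem_range.1 hi)).symm
  refine ⟨L, A, ?_, fun i hi => hA i (Finset.mem_range.1 (Finset.mem_filter.1 hi).1), ?_⟩
  · -- the ratio bound: `a |D| ≤ b |L|`
    have hℓ1 : 1 ≤ ℓ := by omega
    have hRcard : R.card ≤ h * ℓ := by
      calc R.card ≤ ∑ i ∈ Finset.range h, (A i).card := Finset.card_biUnion_le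
        _ = ∑ i ∈ Finset.range h, ℓ :=
            Finset.sum_congr rfl fun i hi => (hA i (Finset.mem_range.1 hi)).2.2
        _ = h * ℓ := by rw [Finset.sum_const, Finset.card_range, smul_eq_mul]
    have hXsmall : a * X.card ≤ 2 * b * R.card :=
      card_le_of_slack hN hexp (hX.trans Finset.sdiff_subset) hX4 hXs
    have hloss' : 16 * b * (R.card + X.card) ≤ a * N := by
      have h1 : a * (16 * b * (R.card + X.card)) ≤ a * (a * N) := by
        calc a * (16 * b * (R.card + X.card))
            = 16 * b * (a * R.card) + 16 * b * (a * X.card) := by ring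
          _ ≤ 16 * b * (a * R.card) + 16 * b * (2 * b * R.card) := by gcongr
          _ = 16 * b * R.card * (a + 2 * b) := by ring
          _ ≤ 16 * b * (h * ℓ) * (a + 2 * b) := by gcongr
          _ ≤ a * (a * N) := le_of_le_of_eq hbud (by ring)
      exact Nat.le_of_mul_le_mul_left h1 ha
    have hDR : D.biUnion A ⊆ R :=
      Finset.biUnion_subset_biUnion_of_subset_left A (Finset.filter_subset _ _)
    have hDcard : (D.biUnion A).card = D.card * ℓ := by
      rw [Finset.card_biUnion fun i hi j hj hne => hdisj i (Finset.filter_subset _ _ hi) j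
        (Finset.filter_subset _ _ hj) hne]
      calc ∑ i ∈ D, (A i).card = ∑ i ∈ D, ℓ := Finset.sum_congr rfl fun i hi =>
            (hA i (Finset.mem_range.1 (Finset.mem_filter.1 hi).1)).2.2
        _ = D.card * ℓ := by rw [Finset.sum_const, smul_eq_mul]
    have hDX : Disjoint (D.biUnion A) X := Finset.disjoint_left.2 fun x hx hxX =>
      (Finset.mem_sdiff.1 (hX hxX)).2 (hDR hx)
    set Q := D.biUnion A ∪ X with hQ
    have hQcard : Q.card = D.card * ℓ + X.card := by
      rw [hQ, Finset.card_union_of_disjoint hDX, hDcard]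
    have hQU : Q ⊆ U := Finset.union_subset (hDR.trans hRU) (hX.trans Finset.sdiff_subset)
    have hQ2 : 2 * Q.card ≤ N := by
      have h1 : Q.card ≤ R.card + X.card := by
        rw [hQ]
        exact (Finset.card_union_le _ _).trans (Nat.add_le_add_right (Finset.card_le_card hDR) _)
      have h2 : 16 * b * (R.card + X.card) ≤ b * N := hloss'.trans (Nat.mul_le_mul_right _ hab)
      have h3 : b * (16 * (R.card + X.card)) ≤ b * N := by linarith
      have h4 := Nat.le_of_mul_le_mul_left h3 (by omega)
      omega
    -- neighbours of the dead region
    have hnbrQ : nbr S U Q ⊆ L.biUnion A ∪ (nbr S U X \ R) := by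
      intro z hz
      obtain ⟨hzU, hzQ, y, hy, hyz⟩ := mem_nbr.1 hz
      by_cases hzR : z ∈ R
      · obtain ⟨i, hi, hzi⟩ := Finset.mem_biUnion.1 hzR
        refine Finset.mem_union_left _ (Finset.mem_biUnion.2 ⟨i, ?_, hzi⟩)
        rw [hL, Finset.mem_filter]
        refine ⟨hi, ?_⟩
        by_contra hnl
        exact hzQ (Finset.mem_union_left _
          (Finset.mem_biUnion.2 ⟨i, Finset.mem_filter.2 ⟨hi, hnl⟩, hzi⟩))
      · have hzX : z ∉ X := fun h => hzQ (Finset.mem_union_right _ h)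
        have hzC : z ∈ (U \ R) \ X := Finset.mem_sdiff.2 ⟨Finset.mem_sdiff.2 ⟨hzU, hzR⟩, hzX⟩
        rcases Finset.mem_union.1 hy with hy | hy
        · exfalso
          obtain ⟨i, hi, hyi⟩ := Finset.mem_biUnion.1 hy
          exact (Finset.mem_filter.1 hi).2 ⟨y, hyi, z, hzC, hyz⟩
        · exact Finset.mem_union_right _
            (Finset.mem_sdiff.2 ⟨mem_nbr.2 ⟨hzU, hzX, y, hy, hyz⟩, hzR⟩)
    have hLcard : (L.biUnion A).card ≤ L.card * ℓ := by
      calc (L.biUnion A).card ≤ ∑ i ∈ L, (A i).card := Finset.card_biUnion_le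
        _ = ∑ i ∈ L, ℓ := Finset.sum_congr rfl fun i hi =>
            (hA i (Finset.mem_range.1 (Finset.mem_filter.1 hi).1)).2.2
        _ = L.card * ℓ := by rw [Finset.sum_const, smul_eq_mul]
    have hexpQ := hexp Q hQU hQ2
    have hnc : (nbr S U Q).card ≤ L.card * ℓ + (nbr S U X \ R).card :=
      (Finset.card_le_card hnbrQ).trans
        ((Finset.card_union_le _ _).trans (Nat.add_le_add_right hLcard _))
    have hDL : a * D.card ≤ b * L.card := by
      have h1 : a * (D.card * ℓ) * 2 ≤ b * (L.card * ℓ) * 2 := by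
        have h2 : b * (nbr S U Q).card ≤ b * (L.card * ℓ) + b * (nbr S U X \ R).card := by
          calc b * (nbr S U Q).card ≤ b * (L.card * ℓ + (nbr S U X \ R).card) :=
                Nat.mul_le_mul_left _ hnc
            _ = _ := by ring
        rw [hQcard] at hexpQ
        nlinarith
      have h3 : ℓ * (a * D.card) ≤ ℓ * (b * L.card) := by linarith
      exact Nat.le_of_mul_le_mul_left h3 (by omega)
    have hcard : D.card + L.card = h := by
      rw [hD, hL, add_comm, Finset.card_filter_add_card_filter_not, Finset.card_range]
    nlinarith
  · intro i hi j hj hne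
    have hi' := Finset.mem_filter.1 hi
    have hj' := Finset.mem_filter.1 hj
    refine ⟨hdisj i hi'.1 j hj'.1 hne, ?_⟩
    rcases lt_or_gt_of_ne hne with h1 | h1
    · exact hcliq i j h1 (Finset.mem_range.1 hj'.1) hi'.2
    · obtain ⟨x, hx, y, hy, hxy⟩ := hcliq j i h1 (Finset.mem_range.1 hi'.1) hj'.2
      exact ⟨y, hy, x, hx, adj_symm hxy⟩

/-- **Indexed form.** Under the hypotheses of `exists_clique_minor_of_expander`, for every `M`
with `(a+b) M ≤ a h` there are `M` pairwise disjoint, pairwise adjacent, connected `ℓ`-sets of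
rows of `U`. [cite: KrivelevichSudakov2009Minors, Thm. 1.1] -/
theorem exists_clique_minor_fin (hN : U.card = N) (ha : 1 ≤ a) (hb : 1 ≤ b) (hab : a ≤ b)
    (hexp : ∀ W ⊆ U, 2 * W.card ≤ N → a * W.card ≤ b * (nbr S U W).card)
    (ht₁ : (2 * b) ^ t₁ * N < (2 * b + a) ^ t₁)
    (hℓ : 1 + h * (2 * (t₁ + 6 * b) + 2) ≤ ℓ)
    (hbud : 16 * b * (h * ℓ) * (a + 2 * b) ≤ a * a * N) {M : ℕ} (hM : (a + b) * M ≤ a * h) :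
    ∃ T : Fin M → Finset ι, (∀ p, T p ⊆ U ∧ IsConn S (T p) ∧ (T p).card = ℓ) ∧
      ∀ p q, p ≠ q → Disjoint (T p) (T q) ∧ ∃ x ∈ T p, ∃ y ∈ T q, (S x ∩ S y).Nonempty := by
  classical
  obtain ⟨G, A, hG, hA, hadj⟩ := exists_clique_minor_of_expander hN ha hb hab hexp ht₁ hℓ hbud
  have hMG : M ≤ G.card := by
    have : (a + b) * M ≤ (a + b) * G.card := hM.trans hG
    exact Nat.le_of_mul_le_mul_left this (by omega)
  set f : Fin M → ℕ := fun p => (G.equivFin.symm (Fin.castLE hMG p)).1 with hf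
  have hfG : ∀ p, f p ∈ G := fun p => (G.equivFin.symm (Fin.castLE hMG p)).2
  have hfinj : Function.Injective f := by
    intro p q hpq
    exact Fin.castLE_injective hMG (G.equivFin.symm.injective (Subtype.ext hpq))
  exact ⟨fun p => A (f p), fun p => hA (f p) (hfG p), fun p q hpq =>
    hadj (f p) (hfG p) (f q) (hfG q) fun h => hpq (hfinj h)⟩

end Iteration

end Summit.PneNP.PneNP.Theorems.ColumnTwo
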